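import Summits.BirchSwinnertonDyer.BirchSwinnertonDyer.Theorems.KimAtThreeKolyvaginCertificateDictionary
import HarnessLib

/-!
# Route `KimAtThreeKolyvagin` (rung W2): NECESSITY — what the leaf itself forces of the three cruxes on its own regime

The route proves the leaf `N11.KimAtThreeRankZeroPUB` (tower, `t = 0` i.e. `#E(ℚ₃)[3] = 1`, `Ш`
finite, newform with `3`-integral plus symbols, `ord(δ̃) = 0` ⟹ `∂^{(∞)}(δ̃) = d ∧ ∂⁽⁰⁾ = ord₃ #Ш(3) + d`)
from the cruxes 19075 `DeepLowerAtThree`, 19076 `DeepUpperAtThree`, 19077 `ShallowEqDeepAtTorsionFree`.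
Conversely, ON THE LEAF'S OWN REGIME (`t = 0`) the leaf already forces:
* `deepLower_tZero_of_leaf` — the conclusion of `DeepLowerAtThree` (since `∂^{(∞)} ≤ ∂^{(∞)}_{deep}`,
  `kuriharaPartialInfty_le_kuriharaPartialDeepInfty`, and the deep limit is finite in rank `0`);
* `deepUpper_iff_shallowEqDeep_of_leaf` — the conclusions of `DeepUpperAtThree` and of
  `ShallowEqDeepAtTorsionFree` are EQUIVALENT given the leaf's equality.
So on `t = 0` rows no crux overshoots the leaf except through the single statement
"`∂^{(∞)}_{deep} ≤ ∂^{(∞)}`" (= 19077 ⟺ 19076 there); the extra strength of 19075/19076 lies entirely on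
the `t ≥ 1` rows (memo Theorem A-t), outside the leaf. Tribunal axis T1 (strength) bookkeeping;
nothing asserted (the leaf is carried as a hypothesis BY NAME).
[cite: Kim2025RefinedTNC, Thm 1.1, Thm 1.2] [cite: MazurRubin2004, Def. 5.2.11, Thm. 5.2.12 (i)]
[cite: Kim2022StructureSelmer, §1.5.1 (PDF p. 7)]
-/

set_option autoImplicit false
-- the Theorems namespace of a single-conjunct summit repeats the summit name by design (D-0017)
set_option linter.dupNamespace false

noncomputable section

open scoped MatrixGroups ModularForm Classical

open CongruenceSubgroup WeierstrassCurve Literature.NumberTheory.EllipticCurves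
  Literature.NumberTheory.EllipticCurves.ModularForms

namespace Summit.BirchSwinnertonDyer.BirchSwinnertonDyer.Theorems.KimAtThreeKolyvaginNecessity

open Summit.BirchSwinnertonDyer.Rank1Residual.Additive
open Summit.BirchSwinnertonDyer.BirchSwinnertonDyer.Theses.KimAtThreeKolyvagin
open Summit.BirchSwinnertonDyer.BirchSwinnertonDyer.Theorems.KimAtThreeKolyvaginCertificateDictionary

/-- **The leaf forces `DeepLowerAtThree` on its own regime (`t = 0`).** From
`∂^{(∞)}(δ̃) = d ∧ ∂⁽⁰⁾ = ord₃ #Ш(3) + d`: the deep limit `d'` is finite (`≤ ∂⁽⁰⁾`) and `≥ d`, so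
`∂⁽⁰⁾ = ord₃ #Ш(3) + d ≤ ord₃ #Ш(3) + d'`. [cite: Kim2025RefinedTNC, Thm 1.1] [cite: MazurRubin2004, Def. 5.2.11] -/
theorem deepLower_tZero_of_leaf (h : N11.KimAtThreeRankZeroPUB)
    (W : WeierstrassCurve ℚ) [W.IsElliptic] [W.IsGloballyMinimal]
    (htower : ∀ n : ℕ, W.HasSurjectiveModNGaloisRep (3 ^ n : ℕ))
    (ht0 : Nat.card {Q : (W.baseChange ℚ_[3]).toAffine.Point // (3 : ℕ) • Q = 0} = 1)
    (hfin : Finite W.sha) {N : ℕ} [NeZero N] (f : CuspForm (Gamma0 N) 2) (hf : IsNewformOf W f)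
    (hint : ∀ r : ℚ, ratPlusSymbol f r ≠ 0 → 0 ≤ padicValRat 3 (ratPlusSymbol f r))
    (hord : kuriharaVanishingOrder W 3 f = 0) :
    ∃ d : ℕ, kuriharaPartialDeepInfty W 3 f = d ∧
      kuriharaPartial W 3 f 0 ≤
        ((padicValNat 3 (Nat.card (AddCommGroup.primaryComponent W.sha 3)) + d : ℕ) : ℕ∞) := by
  obtain ⟨d, hd, heq⟩ := h W htower ht0 hfin f hf hint hord
  obtain ⟨d', hd'⟩ :=
    exists_kuriharaPartialDeepInfty_eq_natCast_of_kuriharaVanishingOrder_eq_zero W 3 f hord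
  refine ⟨d', hd', ?_⟩
  have hdd' : (d : ℕ∞) ≤ d' := by
    rw [← hd, ← hd']
    exact kuriharaPartialInfty_le_kuriharaPartialDeepInfty W 3 f
  have hle : d ≤ d' := by exact_mod_cast hdd'
  rw [heq]
  exact_mod_cast Nat.add_le_add_left hle _

/-- **Given the leaf, `DeepUpperAtThree` and `ShallowEqDeepAtTorsionFree` say the same thing on `t = 0`
rows**: with `∂⁽⁰⁾ = ord₃ #Ш(3) + ∂^{(∞)}`, "`ord₃ #Ш(3) + ∂^{(∞)}_{deep} ≤ ∂⁽⁰⁾`" ⟺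
"`∂^{(∞)}_{deep} ≤ ∂^{(∞)}`". [cite: Kim2025RefinedTNC, Thm 1.1] [cite: MazurRubin2004, Def. 5.2.11, Thm. 5.2.12 (i)] -/
theorem deepUpper_iff_shallowEqDeep_of_leaf (h : N11.KimAtThreeRankZeroPUB)
    (W : WeierstrassCurve ℚ) [W.IsElliptic] [W.IsGloballyMinimal]
    (htower : ∀ n : ℕ, W.HasSurjectiveModNGaloisRep (3 ^ n : ℕ))
    (ht0 : Nat.card {Q : (W.baseChange ℚ_[3]).toAffine.Point // (3 : ℕ) • Q = 0} = 1)
    (hfin : Finite W.sha) {N : ℕ} [NeZero N] (f : CuspForm (Gamma0 N) 2) (hf : IsNewformOf W f)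
    (hint : ∀ r : ℚ, ratPlusSymbol f r ≠ 0 → 0 ≤ padicValRat 3 (ratPlusSymbol f r))
    (hord : kuriharaVanishingOrder W 3 f = 0) :
    (∃ d : ℕ, kuriharaPartialDeepInfty W 3 f = d ∧
        ((padicValNat 3 (Nat.card (AddCommGroup.primaryComponent W.sha 3)) + d : ℕ) : ℕ∞) ≤
          kuriharaPartial W 3 f 0) ↔
      kuriharaPartialDeepInfty W 3 f ≤ kuriharaPartialInfty W 3 f := by
  obtain ⟨d, hd, heq⟩ := h W htower ht0 hfin f hf hint hord
  obtain ⟨d', hd'⟩ :=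
    exists_kuriharaPartialDeepInfty_eq_natCast_of_kuriharaVanishingOrder_eq_zero W 3 f hord
  rw [hd, hd', heq]
  constructor
  · rintro ⟨d'', hd'', hle⟩
    have hdd : d' = d'' := by exact_mod_cast hd''
    subst hdd
    have : padicValNat 3 (Nat.card (AddCommGroup.primaryComponent W.sha 3)) + d' ≤
        padicValNat 3 (Nat.card (AddCommGroup.primaryComponent W.sha 3)) + d := by exact_mod_cast hle
    exact_mod_cast Nat.le_of_add_le_add_left this
  · intro hle
    refine ⟨d', rfl, ?_⟩
    have : d' ≤ d := by exact_mod_cast hle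
    exact_mod_cast Nat.add_le_add_left this _

/-- **Hence, on `t = 0` rows, crux `DeepUpperAtThree` follows from the leaf and crux
`ShallowEqDeepAtTorsionFree`** (the leaf's equality + "deep ≤ shallow"). [cite: Kim2025RefinedTNC, Thm 1.1] -/
theorem deepUpper_tZero_of_leaf_of_shallowEqDeep (h : N11.KimAtThreeRankZeroPUB)
    (hS : ShallowEqDeepAtTorsionFree)
    (W : WeierstrassCurve ℚ) [W.IsElliptic] [W.IsGloballyMinimal]
    (htower : ∀ n : ℕ, W.HasSurjectiveModNGaloisRep (3 ^ n : ℕ))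
    (ht0 : Nat.card {Q : (W.baseChange ℚ_[3]).toAffine.Point // (3 : ℕ) • Q = 0} = 1)
    (hfin : Finite W.sha) {N : ℕ} [NeZero N] (f : CuspForm (Gamma0 N) 2) (hf : IsNewformOf W f)
    (hint : ∀ r : ℚ, ratPlusSymbol f r ≠ 0 → 0 ≤ padicValRat 3 (ratPlusSymbol f r))
    (hord : kuriharaVanishingOrder W 3 f = 0) :
    ∃ d : ℕ, kuriharaPartialDeepInfty W 3 f = d ∧
      ((padicValNat 3 (Nat.card (AddCommGroup.primaryComponent W.sha 3)) + d : ℕ) : ℕ∞) ≤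
        kuriharaPartial W 3 f 0 :=
  (deepUpper_iff_shallowEqDeep_of_leaf h W htower ht0 hfin f hf hint hord).mpr
    (hS W htower ht0 hfin f hf hint hord)

end Summit.BirchSwinnertonDyer.BirchSwinnertonDyer.Theorems.KimAtThreeKolyvaginNecessity

end
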